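import Summits.CriticalPhenomena.SAWScalingLimit.Theses.SAWImaginaryGeometry
import Summits.CriticalPhenomena.SAWScalingLimit.Theorems.SubseqIdentification.Negative.Necessity
import Literature.Probability.RandomPlanarGeometry.ObservableClockPassage
import Literature.Probability.RandomPlanarGeometry.DrivingProcessWeakLimitVarying
import Literature.Probability.RandomPlanarGeometry.FlowLineEdgeData
import Literature.Probability.RandomPlanarGeometry.SAWExplorationFirstPassage
import Literature.Probability.LatticeModels.SlitEdgeDirichlet

/-!
# Line `ksclock` — alternative registered skeleton for the crux `IGMartingaleLimit` (stmt-CriticalPhenomena-5942)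

Strategist line (crux-strategist seat `cstrat-stmt-CriticalPhenomena-5942-s2`, 2026-08-17), registered
`--alt` next to the live skeleton `Lines/birth.lean` (never overwritten). Crux (FIXED; rank 2 of
`route-CriticalPhenomena-SAWImaginaryGeometry`):
`Summit.CriticalPhenomena.SAWScalingLimit.Theses.SAWImaginaryGeometry.IGMartingaleLimit` — for every
probability subsequential weak limit `μ` of the critical `δℤ²` SAW laws, every chordal uniformizing map `φ`
and `μ`-a.e. describability, the time-limited κ = 8/3 imaginary-geometry observable
`H_t(z) = arg(g_t(z) − W_t) + (1/3) arg g_t′(z)`, `W = drivingFunction φ c`, satisfies the cylinder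
(martingale) identity.

## The cut — TRANSFER of the solved sibling's lattice-data assembly (FK-Ising, CDHKS 2014 §3, tree file
## `LatticeModels/FKIsingLatticeDataAssembly.lean`, `exists_observableMartingale_fkInterface_of_latticeData`)

The sibling decides exactly this step ("the discrete observable martingale passes to the limit") from three
lattice inputs — (1) approximating chordal uniformizing maps `φ_k → φ`, (2) Kemppainen–Smirnov BOX TIGHTNESS
of the curves read through `φ_k` (the output of Condition G2), (3) CAPACITY CLOCKS + the DOOB MARTINGALE
`E[X_k | 𝒢_n]` of one bounded variable approximating the observable at clock times — through three PROVED tree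
theorems: `ae_isLoewnerDescribable_and_tendstoInDistribution_drivingPath_varying` (KS Thm 1.5/Cor 1.7–1.8 in
approximating domains), the transport of convergence in distribution to the lattice spaces, and the clock
packaging `Loewner.exists_discreteMartingaleData_of_clocks_of` feeding the passage theorem
`Loewner.integral_cylinder_eq_zero_of_discreteMartingales`. For the SAW, (1)+(2) transfer in SHAPE (stub K, the
engine of the route's crux 4 / EventualTight), the packaging transfers VERBATIM (proved below), and the
non-transferring input is Smirnov's slit-domain convergence theorem: the SAW has no discrete-holomorphic
observable (barriers `ParafermionicHalfCauchyRiemann`, `NienhuisWeightsExcludeVertexSAW`). In its place the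
line NAMES the observable in (3): the Doob martingale of the (clipped, recentred) HYBRID LATTICE FLOW-LINE
FUNCTIONAL `X_γ(z)` of the walk — the edge-data discrete harmonic extension (`slitEdgeDirichletExtension`,
landed D1) into `Ω_δ ∖ γ` of imaginary-geometry data: towards an exterior site, the exact continuum time-zero
IG function `arg ψ + (1/3)·Arg ψ′` (`ψ = φ⁻¹`) sampled at the interior vertex (texture-free arcs); towards a
path vertex, Miller–Sheffield bank data `π − sΘ` / `s(π − Θ)` (landed D2 case table `FlowLine.bankDatum`)
with the raw lattice heading replaced by the canonically unwrapped CENTRED-WINDOW heading `Θ_h` (texture-free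
banks; the recipe of `LatticeFlowLineCanonicalWindow.lean`). The two lattice statements about it are the
route's own layer-2 children, now typeable because D1/D2 landed:

* stub M `stub_flowLineMeanValue` — `SAWFlowLineMeanValue`: the CONDITIONAL lattice flow-line mean-value
  identity of the critical SAW (route crux r3 `FlowLineMeanValue`, stmt-CriticalPhenomena-6979, in hybrid,
  unclipped conditional form): the cylinder average of `X_γ(z)` over the walks extending a past `p` is
  within `ε` of `X_p(z)` whenever `z` is `R` lattice units away from `∂(Ω_δ ∖ p)` and macroscopically in
  the bulk, eventually in `δ`, for EVERY past. Mesh-free content, numerically falsifiable (κ-dressing test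
  of the route header).
* stub C `stub_latticeIGClock` — `SAWFlowLineMeanValue → SAWLatticeIGClock`: given the mean-value engine,
  the clock-form approximation (3) holds with the NAMED variable: off a small event, at every step `n` whose
  capacity clock is `≤ t + Δ_k`, the Doob martingale of the clipped recentred functional is within `ε_k` of
  `H_{θ_n}(V^k)(z)`, `V^k` = the driving function of the (boundary-extended) lattice curve through `φ_k`.
  Content: WINDING STATISTIC (window-chord bank angles of KS-regular lattice curves → `(1/3)·arg g_t′`-part
  in harmonic-measure-weighted sense: deterministic potential theory of Loewner slits), capacity-clock
  regularity (KS), Doob identity (`SAW.exists_explorationFiltration_runningMax_lt`, tree) and clipping.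
* stub K `stub_sawKSData` — `SAWKSData`: for BOUNDARY-ATTACHED endpoint approximations, approximating marked
  domains / uniformizers `(D_k, φ_k) → (D, φ)` and boundary-extension maps `Y_k` (uniformly `o(1)`-close to
  the lattice curve, same weak limit) with Kemppainen–Smirnov box tightness. Open: Condition G2 for the
  x_c-SAW (no RSW/FKG at n = 0); = the engine of crux 4 `SubseqDescribable` and of `EventualTight`.
* stub E `stub_endpointTransfer` — `SAWEndpointTransfer`: every probability subsequential limit of the SAW
  curve laws along ANY endpoint approximation is the limit, along the same meshes, of the laws of a
  BOUNDARY-ATTACHED approximation. Types the route header's interior-endpoint caveat (EndpointRobust,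
  stmt-CriticalPhenomena-0776): `IsEndpointApprox` admits `a_δ` at depth `≫ δ`, for which no KS box through a
  uniformizer exists (the curve must start on `∂D_k`). Implied by `SAWScalingLimit` as typed; much weaker.
* stub A `stub_igContinuity` — `IGFunctionalContinuous`: joint continuity of the time-limited IG functional
  in (time, driver); verbatim the statement of `birth`'s S-A over this file's copy of the vocabulary
  (provable now; one proof closes both).

Composition `IGMartingaleLimit_of` (kernel-checked, no `sorry` of its own): endpoint transfer (E) ⇒ shift the
mesh sequence to probability laws and positive meshes ⇒ KS data (K) ⇒ KS theorem in approximating domains +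
transport ⇒ `V^k → W` in distribution on the lattice spaces ⇒ clock data (C, fed by M) ⇒ clock packaging ⇒
passage theorem for `s' < t₁ < T(z)` (A gives the continuity, `|H| ≤ 6` the bound) ⇒ extension to all
`s' ≤ t'` (frozen functional, dominated convergence) ⇒ real part. Vocabulary `igTime/igObservable/igProcess/
igFunctional` and the frozen-extension lemma are copied from `Lines/birth.lean` so that the two lines stay
independent files (bodies identical, hence definitionally equal statements of stub A).

Why it dodges birth's stuck shape: birth's S-B `IGLimitData` is one `∃V ∃F`-statement carrying the whole
lattice side with nothing named; here (J) and (D) are separated along the printed proof's seams with every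
existential given its canonical witness shape, the observable is NAMED (so the route's physics `FlowLineMeanValue`
is a registered, typed, numerically testable stub instead of an informal item), the KS part is literally the
shared engine of crux 4, and the interior-endpoint artefact is isolated in its own stub.

Disproof used: none on file (no `Disproof.lean`, no `Negative/` lemma, no dead line for this crux).
Negatives index: the refuted all-δ tightness (stmt-CriticalPhenomena-0772) is not used (everything is along
probability subsequences). Texture check (strategist, `compute/texture_bias2.py`): raw lattice headings of a
staircase carry a mesh-independent harmonic-measure-weighted bias (≈ 0.03 rad at slope π/8), which is why the
arcs carry continuum data and the banks window data here (the route's raw-tangent D2 rule would make M false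
at the 5·10⁻³ level in slanted domains).
-/

noncomputable section

open MeasureTheory Filter Topology Set Complex Metric
open scoped NNReal ENNReal BoundedContinuousFunction Real
open UpperHalfPlane (upperHalfPlaneSet)
open Literature.Probability.RandomPlanarGeometry Literature.Probability.LatticeModels
open scoped Literature.Probability.RandomPlanarGeometry.PathBorel

namespace Summit.CriticalPhenomena.SAWScalingLimit.Cruxes.IGMartingaleLimit.KSClock

/-! ### 1. Continuum vocabulary (copied verbatim from `Lines/birth.lean`, same bodies) -/

/-- CDHKS's time horizon at the bulk point `z`: `T(z) = (Im z)²/9`. -/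
def igTime (z : ℂ) : ℝ≥0 :=
  (z.im ^ 2 / 9).toNNReal

/-- The κ = 8/3 imaginary-geometry observable `H_t(z) = arg(g_t(z) − W_t) + (1/3)·arg g_t′(z)`. -/
def igObservable (W : ℝ≥0 → ℝ) (t : ℝ≥0) (z : ℂ) : ℝ :=
  Complex.arg (Loewner.map W t z - (W t : ℂ)) +
    (1 / 3 : ℝ) * Complex.arg (deriv (Loewner.map W t) z)

/-- The time-limited IG observable process `(u, ω) ↦ H_{u ∧ T(z)}(z)` of a real process `W`. -/
def igProcess {Ω : Type*} (W : ℝ≥0 → Ω → ℝ) (z : ℂ) (u : ℝ≥0) (ω : Ω) : ℝ :=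
  igObservable (fun r ↦ W r ω) (min u (igTime z)) z

/-- The time-limited IG functional on driving-path space, complex-valued. -/
def igFunctional (z : ℂ) (u : ℝ≥0) (w : C(ℝ≥0, ℝ)) : ℂ :=
  (igObservable w (min u (igTime z)) z : ℂ)

/-- The IG functional is bounded: `|H| ≤ π + π/3 ≤ 6`. -/
theorem norm_igFunctional_le (z : ℂ) (u : ℝ≥0) (w : C(ℝ≥0, ℝ)) : ‖igFunctional z u w‖ ≤ 6 := by
  unfold igFunctional igObservable
  rw [Complex.norm_real, Real.norm_eq_abs]
  have h1 := Complex.abs_arg_le_pi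
    (Loewner.map (⇑w) (min u (igTime z)) z - ((w (min u (igTime z)) : ℝ) : ℂ))
  have h2 := Complex.abs_arg_le_pi (deriv (Loewner.map (⇑w) (min u (igTime z))) z)
  have hπ := Real.pi_le_four
  refine (abs_add_le _ _).trans ?_
  rw [abs_mul, abs_of_pos (by norm_num : (0 : ℝ) < 1 / 3)]
  nlinarith

/-- The IG functional is frozen after the time horizon `T(z)`. -/
theorem igFunctional_of_le {z : ℂ} {u : ℝ≥0} (hu : igTime z ≤ u) (w : C(ℝ≥0, ℝ)) :
    igFunctional z u w = igFunctional z (igTime z) w := by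
  simp only [igFunctional, min_eq_right hu, min_self]

/-- The time-limited IG process reads the path through the functional (definitional). -/
theorem igProcess_eq_igFunctional {Ω : Type*} (W : ℝ≥0 → Ω → ℝ) (hWc : ∀ ω, Continuous (W · ω))
    (z : ℂ) (u : ℝ≥0) (ω : Ω) :
    (igProcess W z u ω : ℂ) = igFunctional z u ⟨fun r ↦ W r ω, hWc ω⟩ := rfl

/-- **Extension of a cylinder identity past a freezing time** (copied from `Lines/birth.lean`): for a
bounded, jointly continuous path functional `N_u(w)` frozen after `T`, the cylinder identity for
`s < t < T` gives it for every `t ≥ s`. -/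
theorem integral_cylinder_eq_zero_of_forall_lt_of_frozen {Ω : Type*} {mΩ : MeasurableSpace Ω}
    {μ : Measure Ω} [IsProbabilityMeasure μ]
    {W : ℝ≥0 → Ω → ℝ} (hWc : ∀ ω, Continuous (W · ω))
    (hWm : AEMeasurable (fun ω ↦ (⟨fun r ↦ W r ω, hWc ω⟩ : C(ℝ≥0, ℝ))) μ)
    {N : ℝ≥0 → C(ℝ≥0, ℝ) → ℂ} (hNc : Continuous (Function.uncurry N)) {C : ℝ}
    (hNC : ∀ u w, ‖N u w‖ ≤ C) {T : ℝ≥0} (hfreeze : ∀ u : ℝ≥0, T ≤ u → ∀ w, N u w = N T w)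
    {s : ℝ≥0} {n : ℕ} (S : Fin n → ℝ≥0) {ψ : (Fin n → ℝ) → ℝ}
    (hψc : Continuous ψ) (hψ1 : ∀ v, |ψ v| ≤ 1)
    (h : ∀ t : ℝ≥0, s < t → t < T →
      ∫ ω, (N t ⟨fun r ↦ W r ω, hWc ω⟩ - N s ⟨fun r ↦ W r ω, hWc ω⟩) *
        (ψ (fun i ↦ W (S i) ω) : ℂ) ∂μ = 0)
    {t : ℝ≥0} (hst : s ≤ t) :
    ∫ ω, (N t ⟨fun r ↦ W r ω, hWc ω⟩ - N s ⟨fun r ↦ W r ω, hWc ω⟩) *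
      (ψ (fun i ↦ W (S i) ω) : ℂ) ∂μ = 0 := by
  have hC0 : 0 ≤ C := (norm_nonneg _).trans (hNC 0 0)
  have hevalc : Continuous fun w : C(ℝ≥0, ℝ) ↦ (fun i ↦ w (S i) : Fin n → ℝ) :=
    continuous_pi fun i ↦ continuous_eval_const (S i)
  have hNt : ∀ u, Continuous fun w : C(ℝ≥0, ℝ) ↦ N u w := fun u ↦
    hNc.comp (continuous_const.prodMk continuous_id)
  have hNu : ∀ w, Continuous fun u : ℝ≥0 ↦ N u w := fun w ↦
    hNc.comp (continuous_id.prodMk continuous_const)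
  rcases hst.eq_or_lt with rfl | hst'
  · simp
  rcases lt_or_ge t T with htT | htT
  · exact h t hst' htT
  rcases le_or_gt T s with hsT | hsT
  · have h0 : ∀ ω, N t ⟨fun r ↦ W r ω, hWc ω⟩ - N s ⟨fun r ↦ W r ω, hWc ω⟩ = 0 := fun ω ↦ by
      rw [hfreeze t htT, hfreeze s hsT, sub_self]
    simp [h0]
  simp_rw [hfreeze t htT]
  obtain ⟨tm, -, htm_mem, htm_lim⟩ := exists_seq_strictMono_tendsto' hsT
  have hm : ∀ m, ∫ ω, (N (tm m) ⟨fun r ↦ W r ω, hWc ω⟩ - N s ⟨fun r ↦ W r ω, hWc ω⟩) *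
      (ψ (fun i ↦ W (S i) ω) : ℂ) ∂μ = 0 :=
    fun m ↦ h (tm m) (htm_mem m).1 (htm_mem m).2
  have hψC : Continuous fun w : C(ℝ≥0, ℝ) ↦ (ψ (fun i ↦ w (S i)) : ℂ) :=
    continuous_ofReal.comp (hψc.comp hevalc)
  have hmeas : ∀ u : ℝ≥0, AEStronglyMeasurable (fun ω ↦ (N u ⟨fun r ↦ W r ω, hWc ω⟩ -
      N s ⟨fun r ↦ W r ω, hWc ω⟩) * (ψ (fun i ↦ W (S i) ω) : ℂ)) μ := fun u ↦ by
    have hc : Continuous fun w : C(ℝ≥0, ℝ) ↦ (N u w - N s w) * (ψ (fun i ↦ w (S i)) : ℂ) :=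
      ((hNt u).sub (hNt s)).mul hψC
    exact (hc.measurable.comp_aemeasurable hWm).aestronglyMeasurable
  have hbd : ∀ (u : ℝ≥0) ω, ‖(N u ⟨fun r ↦ W r ω, hWc ω⟩ - N s ⟨fun r ↦ W r ω, hWc ω⟩) *
      (ψ (fun i ↦ W (S i) ω) : ℂ)‖ ≤ 2 * C := fun u ω ↦ by
    rw [norm_mul, Complex.norm_real, Real.norm_eq_abs]
    have hu4 := hNC u ⟨fun r ↦ W r ω, hWc ω⟩
    have hs4 := hNC s ⟨fun r ↦ W r ω, hWc ω⟩
    have h1 : ‖N u ⟨fun r ↦ W r ω, hWc ω⟩ - N s ⟨fun r ↦ W r ω, hWc ω⟩‖ ≤ 2 * C :=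
      (norm_sub_le _ _).trans (by linarith)
    calc ‖N u ⟨fun r ↦ W r ω, hWc ω⟩ - N s ⟨fun r ↦ W r ω, hWc ω⟩‖ * |ψ fun i ↦ W (S i) ω|
        ≤ 2 * C * 1 := mul_le_mul h1 (hψ1 _) (abs_nonneg _) (by linarith)
      _ = 2 * C := mul_one _
  have hlim : Tendsto (fun m ↦ ∫ ω, (N (tm m) ⟨fun r ↦ W r ω, hWc ω⟩ -
      N s ⟨fun r ↦ W r ω, hWc ω⟩) * (ψ (fun i ↦ W (S i) ω) : ℂ) ∂μ) atTop
      (𝓝 (∫ ω, (N T ⟨fun r ↦ W r ω, hWc ω⟩ - N s ⟨fun r ↦ W r ω, hWc ω⟩) *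
        (ψ (fun i ↦ W (S i) ω) : ℂ) ∂μ)) := by
    refine tendsto_integral_of_dominated_convergence (fun _ ↦ 2 * C) (fun m ↦ hmeas _)
      (integrable_const _) (fun m ↦ ae_of_all _ fun ω ↦ hbd _ ω) (ae_of_all _ fun ω ↦ ?_)
    exact ((((hNu _).tendsto _).comp htm_lim).sub tendsto_const_nhds).mul tendsto_const_nhds
  have h0 : Tendsto (fun m ↦ ∫ ω, (N (tm m) ⟨fun r ↦ W r ω, hWc ω⟩ -
      N s ⟨fun r ↦ W r ω, hWc ω⟩) * (ψ (fun i ↦ W (S i) ω) : ℂ) ∂μ) atTop (𝓝 0) := by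
    simp_rw [hm]
    exact tendsto_const_nhds
  exact tendsto_nhds_unique hlim h0

/-! ### 2. Lattice vocabulary: boundary attachment and the hybrid flow-line functional -/

/-- **Boundary-attached lattice endpoints**: for all small `δ > 0` the endpoint `a δ ∈ Ω_δ` has a
lattice neighbour `a δ + e_k` OUTSIDE `Ω_δ = meshDomain Ω δ` (the phantom predecessor `a⁻` of the
flow-line data and the edge along which the lattice curve is extended to `∂Ω`). Deep interior endpoints
(allowed by `SAW.IsEndpointApprox`) are excluded. -/
def IsBoundaryAttached (Ω : Set ℂ) (a : ℝ → Site 2) : Prop :=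
  ∀ᶠ δ in 𝓝[>] (0 : ℝ), ∃ k : Fin 4, a δ + cornerUnit k ∉ meshDomain Ω δ

/-- `A` is a **continuous argument of `ψ′` on `Ω`**: continuous on `Ω` with `ψ′(w) = |ψ′(w)| e^{iA(w)}`
(exists for `ψ = φ⁻¹` on the simply connected `Ω`, unique up to `2π`). -/
def IsArgDeriv (Ω : Set ℂ) (ψ : ℂ → ℂ) (A : ℂ → ℝ) : Prop :=
  ContinuousOn A Ω ∧ ∀ w ∈ Ω, deriv ψ w = (‖deriv ψ w‖ : ℂ) * Complex.exp ((A w : ℂ) * Complex.I)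

/-- Direction of the chord of the vertex list `η` across the window of radius `m` centred at index `j`:
`arg (η_{j+m} − η_{j−m})` (indices clamped to the list: `j − m` truncated at `0`, beyond the tip the last
vertex; `arg 0 = 0` for a degenerate chord). -/
def chordArg (η : List (Site 2)) (j m : ℕ) : ℝ :=
  Complex.arg (Site.toComplex (η.getD (j + m) (η.getLastD 0)) -
    Site.toComplex (η.getD (j - m) (η.getLastD 0)))

/-- **Canonically unwrapped centred-window heading** `Θ_h(j)` of the path vertex `η_j`: anchored on the
EXACT lattice lift `θ_j = FlowLine.pathHeading a⁻ η j` (heading of the step into `η_j`, phantom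
predecessor `a⁻`), then the principal values of the increments of the chord directions are accumulated
ring by ring (`Θ = θ_j + pv(arg chord₁ − θ_j) + Σ_{m<h} pv(arg chord_{m+2} − arg chord_{m+1})`, radius
`h + 1`). Texture-free replacement of the raw lattice heading in the bank data (the recipe of
`centredWindowAngleC`, `LatticeFlowLineCanonicalWindow.lean`). -/
def windowHeading (aM : Site 2) (η : List (Site 2)) (h j : ℕ) : ℝ :=
  FlowLine.pathHeading aM η j
    + ((chordArg η j 1 - FlowLine.pathHeading aM η j : ℝ) : Real.Angle).toReal
    + ∑ m ∈ Finset.range h, ((chordArg η j (m + 2) - chordArg η j (m + 1) : ℝ) : Real.Angle).toReal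

/-- **Window bank datum**: the case table of `FlowLine.bankDatum` (tangent `t = i (w − v)` against the
steps `d_in`, `d_out` of the path vertex `w = η_j`; left bank `π − sΘ`, right bank `s(π − Θ)`, tip cap
`π/2 − s(Θ − π/2)`, junk `0`) with the raw lifted headings `θ_j, θ_{j+1}` replaced by the window
headings `Θ_h(j), Θ_h(j+1)`. -/
def bankDatumW (s : ℝ) (aM : Site 2) (η : List (Site 2)) (h : ℕ) (v w : Site 2) : ℝ :=
  let j := η.idxOf w
  let hs := FlowLine.stepDirs (aM :: η)
  let kin := hs.getD j 0
  let kout := hs.getD (j + 1) 0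
  let θin := windowHeading aM η h j
  let θout := windowHeading aM η h (j + 1)
  let t := FlowLine.headingOf (w - v) + 1
  if t = kin then π - s * θin
  else if t = kin + 2 then s * (π - θin)
  else if j + 1 < η.length then
    (if t = kout then π - s * θout else if t = kout + 2 then s * (π - θout) else 0)
  else if t = kin + 3 then π / 2 - s * (θin - π / 2)
  else 0

/-- **Hybrid imaginary-geometry edge data** of the explored lattice domain at mesh `δ`: towards a path
vertex `w ∈ η` the window bank datum; towards any other exterior site the EXACT continuum time-zero IG
function in H-normalisation, `arg ψ(δv) + s · A(δv)` (`ψ = φ⁻¹`, `A` a continuous argument of `ψ′`),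
sampled at the interior vertex `v` — so that the arcs carry no lattice texture. -/
def hybridEdgeData (s δ : ℝ) (ψ : ℂ → ℂ) (A : ℂ → ℝ) (aM : Site 2) (η : List (Site 2)) (h : ℕ)
    (v w : Site 2) : ℝ :=
  if w ∈ η then bankDatumW s aM η h v w
  else Complex.arg (ψ (meshPoint δ v)) + s * A (meshPoint δ v)

/-- **The hybrid lattice flow-line functional** `X_η(z)`: the value at `z` of the edge-data discrete
harmonic extension (`slitEdgeDirichletExtension`, landed definition D1 of the route) into the slit lattice
domain `U ∖ η` of the hybrid IG data. -/
def flowLineFunctional (s δ : ℝ) (U : Set (Site 2)) (ψ : ℂ → ℂ) (A : ℂ → ℝ) (aM : Site 2)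
    (η : List (Site 2)) (h : ℕ) (z : Site 2) : ℝ :=
  slitEdgeDirichletExtension (U \ {x | x ∈ η}) (hybridEdgeData s δ ψ A aM η h) z

/-! ### 3. The five stub statements -/

/-- STUB A statement — **joint continuity of the time-limited IG functional** (same body as birth's
`IGFunctionalContinuous`). -/
def IGFunctionalContinuous : Prop :=
  ∀ z : ℂ, 0 < z.im → Continuous (Function.uncurry (igFunctional z))

/-- STUB E statement — **endpoint transfer**: every probability subsequential weak limit of the critical
SAW curve laws along an arbitrary endpoint approximation `(a, b)` and meshes `s n → 0⁺` is the weak limit,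
along the SAME meshes, of the curve laws of some BOUNDARY-ATTACHED endpoint approximation `(a', b')`. -/
def SAWEndpointTransfer : Prop :=
  ∀ (D : DobrushinDomain) (a b : ℝ → Site 2), SAW.IsEndpointApprox D a b →
    ∀ (s : ℕ → ℝ) (μ : Measure (CurveClass ℂ)), Tendsto s atTop (𝓝[>] (0 : ℝ)) →
      IsProbabilityMeasure μ →
      (∀ f : CurveClass ℂ →ᵇ ℝ, Tendsto (fun n ↦ ∫ γ, f γ.curve
        ∂(SAW.law D.carrier (s n) (a (s n)) (b (s n)))) atTop (𝓝 (∫ x, f x ∂μ))) →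
      ∃ a' b' : ℝ → Site 2, SAW.IsEndpointApprox D a' b' ∧ IsBoundaryAttached D.carrier a' ∧
        IsBoundaryAttached D.carrier b' ∧
        ∀ f : CurveClass ℂ →ᵇ ℝ, Tendsto (fun n ↦ ∫ γ, f γ.curve
          ∂(SAW.law D.carrier (s n) (a' (s n)) (b' (s n)))) atTop (𝓝 (∫ x, f x ∂μ))

/-- STUB K statement — **Kemppainen–Smirnov data of the boundary-attached critical SAW** (shape of inputs
(1)+(2) of `LatticeModels.exists_observableMartingale_fkInterface_of_latticeData`): along any positive
mesh sequence `s k → 0` on which the SAW laws are probability measures converging weakly (pushed to curves)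
to `μ`, there are approximating marked domains with chordal uniformizing maps `(D_k, φ_k) → (D, φ)`
(boundary extensions converge on compacts and at infinity, `b_k → b`) and measurable modifications `Y_k` of
the lattice curve (uniformly `ρ_k`-close to it, `ρ_k → 0`, with the same weak limit `μ` — intended: the
polyline extended along the attaching edges to `∂Ω`, re-marked) whose laws are KS-BOX-TIGHT read through
`φ_k`: for every `ε`, one compact box of Loewner pairs (moduli of the pulled-back curve and of its driving
term, transience profile) carries mass `≥ 1 − ε` at every scale. -/
def SAWKSData : Prop :=
  ∀ (D : DobrushinDomain) (a b : ℝ → Site 2), SAW.IsEndpointApprox D a b →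
    IsBoundaryAttached D.carrier a → IsBoundaryAttached D.carrier b →
    ∀ (φ : ConformalEquiv upperHalfPlaneSet D.carrier), D.IsChordalUniformizing φ →
    ∀ (s : ℕ → ℝ) (μ : Measure (CurveClass ℂ)) [IsProbabilityMeasure μ]
      [∀ k, IsProbabilityMeasure (SAW.law D.carrier (s k) (a (s k)) (b (s k)))],
      (∀ k, 0 < s k) → Tendsto s atTop (𝓝 (0 : ℝ)) →
      (∀ f : CurveClass ℂ →ᵇ ℝ, Tendsto (fun k ↦ ∫ γ, f γ.curve
        ∂(SAW.law D.carrier (s k) (a (s k)) (b (s k)))) atTop (𝓝 (∫ x, f x ∂μ))) →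
      ∃ (Ds : ℕ → DobrushinDomain) (φs : ∀ k, ConformalEquiv upperHalfPlaneSet (Ds k).carrier)
        (Y : ∀ k, SAW.DomainSAW D.carrier (s k) (a (s k)) (b (s k)) → CurveClass ℂ),
        (∀ k, (Ds k).IsChordalUniformizing (φs k)) ∧
        (∀ R : ℝ, TendstoUniformlyOn (fun k ↦ (φs k).boundaryExtension) φ.boundaryExtension
          atTop ({z : ℂ | 0 ≤ z.im} ∩ closedBall 0 R)) ∧
        (∀ ε : ℝ, 0 < ε → ∃ r : ℝ, ∀ᶠ k in atTop, ∀ z : ℂ, z ∈ {z : ℂ | 0 ≤ z.im} → r ≤ ‖z‖ →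
          dist ((φs k).boundaryExtension z) ((Ds k).pt 1) ≤ ε) ∧
        Tendsto (fun k ↦ (Ds k).pt 1) atTop (𝓝 (D.pt 1)) ∧
        (∃ ρ : ℕ → ℝ, Tendsto ρ atTop (𝓝 0) ∧ ∀ k γ, dist (Y k γ) γ.curve ≤ ρ k) ∧
        (∀ f : CurveClass ℂ →ᵇ ℝ, Tendsto (fun k ↦ ∫ γ, f (Y k γ)
          ∂(SAW.law D.carrier (s k) (a (s k)) (b (s k)))) atTop (𝓝 (∫ x, f x ∂μ))) ∧
        (∀ ε : ℝ≥0∞, 0 < ε → ∃ (δγ δW : ℕ → ℝ) (T : ℕ → ℝ≥0), (∀ j, 0 < δγ j) ∧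
          (∀ j, 0 < δW j) ∧
          ∀ k, SAW.law D.carrier (s k) (a (s k)) (b (s k)) ((Y k) ⁻¹'
            ((fun p ↦ compactifiedClass (φs k).boundaryExtension ((Ds k).pt 1) p.1) ''
              {p : C(ℝ≥0, ℂ) × C(ℝ≥0, ℝ) | p ∈ generatedPairs ∧
                p.1 ∈ Literature.Probability.Process.modulusSet ({0} : Set ℂ) δγ ∧
                p.2 ∈ Literature.Probability.Process.modulusSet ({0} : Set ℝ) δW ∧
                ∀ (j : ℕ) (t : ℝ≥0), T j ≤ t → (j : ℝ) ≤ ‖p.1 t‖})ᶜ) ≤ ε)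

/-- STUB M statement — **the conditional lattice flow-line mean-value identity of the critical SAW**
(hybrid form of the route's crux r3 `FlowLineMeanValue`, stmt-CriticalPhenomena-6979). For a Dobrushin
domain with chordal uniformizing map `φ`, a continuous argument `A` of `(φ⁻¹)′`, a compact `K ⊆ Ω` and
`ε > 0` there are a window radius `h` and a lattice distance `R` such that for all small meshes `δ`: for
boundary-attached `a` (phantom predecessor `a⁻ = a + e_k ∉ Ω_δ`, the branch of `A` pinned at the start to
the lattice heading `θ₀` of `a − a⁻` by `|A(δa) − (π/2 − θ₀)| ≤ π`), whenever `Ω_δ` is an induced subgraph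
of `ℤ²`, for every walk `γ`, step `n` (past `p = γ[0,n]`) and vertex `z` of `Ω_δ ∖ p` with `δz ∈ K` at
sup-distance `≥ R` from every site off `Ω_δ ∖ p`, the average of `X_{γ'}(z)` over the walks `γ'`
extending the past (the cylinder of `p` under the critical law — a finite sum) is within `ε` of `X_p(z)`
(`X` = `flowLineFunctional (1/3)`, UNCLIPPED: the identity is linear in the data, so the absolute winding
level of an adversarial past drops out; integrability/clipping is the business of stub C's bad events).
This is the x_c-SAW's "harmonic explorer plus one third of the winding" rule; its continuum shadow is the
martingale property of Miller–Sheffield's `𝔥_t` at κ = 8/3, conditionally on EVERY past; the coefficient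
`1/3 = (4−κ)/4` is the only dressing compatible with `⟨W⟩ = (8/3)t`. -/
def SAWFlowLineMeanValue : Prop :=
  ∀ (D : DobrushinDomain) (φ : ConformalEquiv upperHalfPlaneSet D.carrier), D.IsChordalUniformizing φ →
  ∀ (A : ℂ → ℝ), IsArgDeriv D.carrier (fun w ↦ φ.symm w) A →
  ∀ (K : Set ℂ), IsCompact K → K ⊆ D.carrier →
  ∀ ε : ℝ, 0 < ε → ∃ (h R : ℕ),
    ∀ᶠ δ in 𝓝[>] (0 : ℝ), ∀ (a b aM : Site 2),
      aM ∉ meshDomain D.carrier δ → (∃ k : Fin 4, aM = a + cornerUnit k) →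
      |A (meshPoint δ a) - (π / 2 - FlowLine.pathHeading aM [a] 0)| ≤ π →
      (∀ u ∈ meshDomain D.carrier δ, ∀ v ∈ meshDomain D.carrier δ,
        (∃ k : Fin 4, v = u + cornerUnit k) → (discreteDomainGraph D.carrier δ).Adj u v) →
      ∀ (γ : SAW.DomainSAW D.carrier δ a b) (n : ℕ) (z : Site 2),
        meshPoint δ z ∈ K → z ∈ meshDomain D.carrier δ →
        z ∉ (γ.walk.takeUntil (γ.walk.getVert n) (γ.walk.getVert_mem_support n)).support →
        (∀ w : Site 2, w ∉ meshDomain D.carrier δ \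
            {x | x ∈ (γ.walk.takeUntil (γ.walk.getVert n) (γ.walk.getVert_mem_support n)).support} →
          (R : ℤ) ≤ max |z 0 - w 0| |z 1 - w 1|) →
        |(∫ γ' in {γ' : SAW.DomainSAW D.carrier δ a b |
              ∃ hw : γ.walk.getVert n ∈ γ'.walk.support,
                γ'.walk.takeUntil (γ.walk.getVert n) hw =
                  γ.walk.takeUntil (γ.walk.getVert n) (γ.walk.getVert_mem_support n)},
            flowLineFunctional (1 / 3) δ (meshDomain D.carrier δ) (fun w ↦ φ.symm w) A aM
              γ'.walk.support h z
            ∂(SAW.law D.carrier δ a b)) /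
          ((SAW.law D.carrier δ a b) {γ' : SAW.DomainSAW D.carrier δ a b |
              ∃ hw : γ.walk.getVert n ∈ γ'.walk.support,
                γ'.walk.takeUntil (γ.walk.getVert n) hw =
                  γ.walk.takeUntil (γ.walk.getVert n) (γ.walk.getVert_mem_support n)}).toReal
          - flowLineFunctional (1 / 3) δ (meshDomain D.carrier δ) (fun w ↦ φ.symm w) A aM
              (γ.walk.takeUntil (γ.walk.getVert n) (γ.walk.getVert_mem_support n)).support h z| ≤ ε

/-- STUB C's conclusion — **the lattice IG clock data of the boundary-attached critical SAW with the NAMED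
observable** (shape of input (3) of `LatticeModels.exists_observableMartingale_fkInterface_of_latticeData`,
general-target form consumed by `Loewner.exists_discreteMartingaleData_of_clocks_of`). For every admissible
approximation datum `(D_k, φ_k, Y_k)` (as produced by `SAWKSData`: chordal uniformizing, boundary extensions
converging, `Y_k` uniformly close to the lattice curve, KS-box-tight), every bulk point `z` and capacity
levels `s' < t' < T(z)`: at every scale a filtration of the SAW space (the lattice steps), an ADAPTED
CAPACITY CLOCK `θ` starting below `Δ_k` and reaching `t'` with increments `≤ Δ_k` off a bad event of mass
`≤ η_k`, locality of the driving process `V^k_u = drivingFunction φ_k (Y_k γ) u` with respect to it, and the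
approximation, off the bad event and at all steps of clock `≤ t' + Δ_k`, of the time-limited IG observable
`H_{θ_n}(V^k)(z)` by the Doob martingale `c · E[X | 𝒢_n]` of the NAMED bounded variable
`X(γ) = clip_{[-1,1]}((X_γ(z_k) − X_∅(z_k) + arg z)/L)` (`X` = the hybrid flow-line functional of the FULL
walk at a lattice point `z_k`, recentred by its nothing-explored value, `c = L`), with `ε_k, Δ_k, η_k → 0`. -/
def SAWLatticeIGClock : Prop :=
  ∀ (D : DobrushinDomain) (a b : ℝ → Site 2), SAW.IsEndpointApprox D a b →
    IsBoundaryAttached D.carrier a → IsBoundaryAttached D.carrier b →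
    ∀ (φ : ConformalEquiv upperHalfPlaneSet D.carrier), D.IsChordalUniformizing φ →
    ∀ (s : ℕ → ℝ), (∀ k, 0 < s k) → Tendsto s atTop (𝓝 (0 : ℝ)) →
    ∀ [∀ k, IsProbabilityMeasure (SAW.law D.carrier (s k) (a (s k)) (b (s k)))],
    ∀ (Ds : ℕ → DobrushinDomain) (φs : ∀ k, ConformalEquiv upperHalfPlaneSet (Ds k).carrier)
      (Y : ∀ k, SAW.DomainSAW D.carrier (s k) (a (s k)) (b (s k)) → CurveClass ℂ),
      (∀ k, (Ds k).IsChordalUniformizing (φs k)) →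
      (∀ R : ℝ, TendstoUniformlyOn (fun k ↦ (φs k).boundaryExtension) φ.boundaryExtension
        atTop ({z : ℂ | 0 ≤ z.im} ∩ closedBall 0 R)) →
      (∀ ε : ℝ, 0 < ε → ∃ r : ℝ, ∀ᶠ k in atTop, ∀ z : ℂ, z ∈ {z : ℂ | 0 ≤ z.im} → r ≤ ‖z‖ →
        dist ((φs k).boundaryExtension z) ((Ds k).pt 1) ≤ ε) →
      Tendsto (fun k ↦ (Ds k).pt 1) atTop (𝓝 (D.pt 1)) →
      (∃ ρ : ℕ → ℝ, Tendsto ρ atTop (𝓝 0) ∧ ∀ k γ, dist (Y k γ) γ.curve ≤ ρ k) →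
      (∀ ε : ℝ≥0∞, 0 < ε → ∃ (δγ δW : ℕ → ℝ) (T : ℕ → ℝ≥0), (∀ j, 0 < δγ j) ∧
        (∀ j, 0 < δW j) ∧
        ∀ k, SAW.law D.carrier (s k) (a (s k)) (b (s k)) ((Y k) ⁻¹'
          ((fun p ↦ compactifiedClass (φs k).boundaryExtension ((Ds k).pt 1) p.1) ''
            {p : C(ℝ≥0, ℂ) × C(ℝ≥0, ℝ) | p ∈ generatedPairs ∧
              p.1 ∈ Literature.Probability.Process.modulusSet ({0} : Set ℂ) δγ ∧
              p.2 ∈ Literature.Probability.Process.modulusSet ({0} : Set ℝ) δW ∧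
              ∀ (j : ℕ) (t : ℝ≥0), T j ≤ t → (j : ℝ) ≤ ‖p.1 t‖})ᶜ) ≤ ε) →
      ∀ z : ℂ, 0 < z.im → ∀ s' t' : ℝ≥0, s' < t' → t' < igTime z →
        ∃ (C : ℝ) (ε Δ η : ℕ → ℝ≥0), Tendsto ε atTop (𝓝 0) ∧ Tendsto Δ atTop (𝓝 0) ∧
          Tendsto η atTop (𝓝 0) ∧
          ∀ k, ∃ (𝒢 : Filtration ℕ (inferInstance :
              MeasurableSpace (SAW.DomainSAW D.carrier (s k) (a (s k)) (b (s k)))))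
            (θ : ℕ → SAW.DomainSAW D.carrier (s k) (a (s k)) (b (s k)) → ℝ≥0) (M : ℕ)
            (A : ℂ → ℝ) (aM zk : Site 2) (hW : ℕ) (L : ℝ) (c : ℂ)
            (bad : Set (SAW.DomainSAW D.carrier (s k) (a (s k)) (b (s k)))),
            IsArgDeriv D.carrier (fun w ↦ φ.symm w) A ∧
            Adapted 𝒢 θ ∧ (∀ ω, ω ∉ bad → θ 0 ω ≤ Δ k) ∧
            (∀ u, Measurable[𝒢 M] fun ω ↦ drivingFunction (φs k) (Y k ω) u) ∧
            (∀ n u, Measurable[𝒢 n] ({ω | u ≤ θ n ω}.indicator fun ω ↦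
              drivingFunction (φs k) (Y k ω) u)) ∧
            AEStronglyMeasurable (fun ω ↦ ((max (-1) (min 1
                ((flowLineFunctional (1 / 3) (s k) (meshDomain D.carrier (s k)) (fun w ↦ φ.symm w)
                    A aM ω.walk.support hW zk
                  - flowLineFunctional (1 / 3) (s k) (meshDomain D.carrier (s k)) (fun w ↦ φ.symm w)
                    A aM [] hW zk + Complex.arg z) / L)) : ℝ) : ℂ))
              (SAW.law D.carrier (s k) (a (s k)) (b (s k))) ∧
            (∀ᵐ ω ∂SAW.law D.carrier (s k) (a (s k)) (b (s k)), ‖((max (-1) (min 1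
                ((flowLineFunctional (1 / 3) (s k) (meshDomain D.carrier (s k)) (fun w ↦ φ.symm w)
                    A aM ω.walk.support hW zk
                  - flowLineFunctional (1 / 3) (s k) (meshDomain D.carrier (s k)) (fun w ↦ φ.symm w)
                    A aM [] hW zk + Complex.arg z) / L)) : ℝ) : ℂ)‖ ≤ 1) ∧
            ‖c‖ ≤ C ∧
            MeasurableSet bad ∧ SAW.law D.carrier (s k) (a (s k)) (b (s k)) bad ≤ η k ∧
            (∀ ω, ω ∉ bad → ∃ n ≤ M, t' ≤ θ n ω) ∧
            (∀ ω, ω ∉ bad → ∀ n, n < M → θ (n + 1) ω ≤ θ n ω + Δ k) ∧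
            (∀ᵐ ω ∂SAW.law D.carrier (s k) (a (s k)) (b (s k)), ω ∉ bad → ∀ n, n ≤ M →
              θ n ω ≤ t' + Δ k →
              ‖c * (SAW.law D.carrier (s k) (a (s k)) (b (s k)))[fun ω ↦ ((max (-1) (min 1
                ((flowLineFunctional (1 / 3) (s k) (meshDomain D.carrier (s k)) (fun w ↦ φ.symm w)
                    A aM ω.walk.support hW zk
                  - flowLineFunctional (1 / 3) (s k) (meshDomain D.carrier (s k)) (fun w ↦ φ.symm w)
                    A aM [] hW zk + Complex.arg z) / L)) : ℝ) : ℂ)|𝒢 n] ω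
                - (igProcess (fun u ω ↦ drivingFunction (φs k) (Y k ω) u) z (θ n ω) ω : ℂ)‖ ≤ ε k)

/-! ### 4. The registered stubs (the only `sorry`s of the file) -/

/-- **Stub A `stub_igContinuity`** — `IGFunctionalContinuous` (PROVABLE NOW, size L; same statement as
birth's S-A `stub_igFunctionalContinuous` over identical definitions — one proof closes both): joint
continuity of the time-limited IG functional in (time, driver), by driver stability of `g_t(z) − W_t` and
`g_t′(z)` on `t ≤ T(z)` (`Loewner.ShortTime`, `Loewner.exists_norm_base_sub_base_le_of_le_cdhksTime`-type
estimates) and the continuous branches of `arg`. -/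
theorem stub_igContinuity : IGFunctionalContinuous := by
  sorry

/-- **Stub E `stub_endpointTransfer`** — `SAWEndpointTransfer` (open, size L–XL; implied by the summit as
typed, much weaker): insensitivity of subsequential limits to the microscopic position of the lattice
endpoints (SAW endpoint surgery / boundary Harnack for the x_c-measure; existence of boundary-attached
approximations is elementary from `JordanDomain.exists_forall_mem_meshDomain_and_reachable`). Types the
route header's caveat "EndpointRobust (stmt-CriticalPhenomena-0776) untested". -/
theorem stub_endpointTransfer : SAWEndpointTransfer := by
  sorry

/-- **Stub K `stub_sawKSData`** — `SAWKSData` (OPEN; = Kemppainen–Smirnov Condition G2 for the critical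
SAW in slit domains + KS Prop 3.2 / Thm 3.9–3.10, the engine of crux 4 `SubseqDescribable` and of
`EventualTight`; the approximating marked domains are `(Ω; q_a^k, q_b^k)` with the attaching edges' exit
points as marked points and `φ_k = φ ∘ M_k`, `M_k → id` Möbius; `Y_k` = the polyline extended along the
attaching edges). Why it might fail: no crossing/RSW technology for the SAW (no FKG at n = 0). -/
theorem stub_sawKSData : SAWKSData := by
  sorry

/-- **Stub M `stub_flowLineMeanValue`** — `SAWFlowLineMeanValue` (OPEN-PROBLEM grade, the route's
physics; numerically falsifiable by the κ-dressing test of the route header, run with window bank angles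
and exact arc data): the conditional lattice flow-line mean-value identity of the x_c-SAW. -/
theorem stub_flowLineMeanValue : SAWFlowLineMeanValue := by
  sorry

/-- **Stub C `stub_latticeIGClock`** — `SAWFlowLineMeanValue → SAWLatticeIGClock` (open, size XL; given
the mean-value engine: the WINDING STATISTIC — window-chord bank angles of KS-regular lattice curves
reproduce the `arg(g_t − W_t) + (1/3) arg g_t′`-part of the continuum function in harmonic-measure-weighted
sense, deterministic potential theory of Loewner slits with Beurling-type estimates for the `h` provisional
tip windows — plus capacity-clock regularity from the KS boxes, the Doob identity
`SAW.exists_explorationFiltration_runningMax_lt`, and the clipping/integrability of the recentred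
functional through annealed second-moment bounds absorbed in the bad events). -/
theorem stub_latticeIGClock : SAWFlowLineMeanValue → SAWLatticeIGClock := by
  sorry

/-! ### Name-keyed aliases of the stub statements (hypotheses of `IGMartingaleLimit_of`; device of
`Lines/birth.lean`: the `__Registered` namespace is an implementation detail) -/
namespace __Registered

/-- Alias of `IGFunctionalContinuous` keyed by the registered stub name. -/
abbrev stub_igContinuity : Prop := IGFunctionalContinuous
/-- Alias of `SAWEndpointTransfer` keyed by the registered stub name. -/
abbrev stub_endpointTransfer : Prop := SAWEndpointTransfer
/-- Alias of `SAWKSData` keyed by the registered stub name. -/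
abbrev stub_sawKSData : Prop := SAWKSData
/-- Alias of `SAWFlowLineMeanValue` keyed by the registered stub name. -/
abbrev stub_flowLineMeanValue : Prop := SAWFlowLineMeanValue
/-- Alias of `SAWFlowLineMeanValue → SAWLatticeIGClock` keyed by the registered stub name. -/
abbrev stub_latticeIGClock : Prop := SAWFlowLineMeanValue → SAWLatticeIGClock

end __Registered

/-! ### 5. Sorry-free glue: convergence in distribution through a change of sample space -/

/-- **Convergence in distribution is a property of the laws** (copied from
`LatticeModels/FKIsingLatticeDataAssembly.lean`): if `X_i → Z` in distribution on `(Ω_i, μ_i)` and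
`Y_i : Ω₀_i → Ω_i` are a.e.-measurable with `(P_i).map Y_i = μ_i`, then `X_i ∘ Y_i → Z` in distribution
on `(Ω₀_i, P_i)`. [folklore] -/
theorem tendstoInDistribution_comp_of_map_eq {ι E : Type*} {Ω Ω₀ : ι → Type*}
    {m : ∀ i, MeasurableSpace (Ω i)} {m₀ : ∀ i, MeasurableSpace (Ω₀ i)}
    {μ : ∀ i, Measure (Ω i)} [∀ i, IsProbabilityMeasure (μ i)]
    {P : ∀ i, Measure (Ω₀ i)} [∀ i, IsProbabilityMeasure (P i)]
    {Ω' : Type*} {m' : MeasurableSpace Ω'} {μ' : Measure Ω'} [IsProbabilityMeasure μ']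
    [TopologicalSpace E] [MeasurableSpace E] [OpensMeasurableSpace E]
    {X : ∀ i, Ω i → E} {Z : Ω' → E} {l : Filter ι}
    (h : TendstoInDistribution X l Z μ μ') (Y : ∀ i, Ω₀ i → Ω i)
    (hY : ∀ i, AEMeasurable (Y i) (P i)) (hmap : ∀ i, (P i).map (Y i) = μ i) :
    TendstoInDistribution (fun i ω ↦ X i (Y i ω)) l Z P μ' := by
  have hX : ∀ i, AEMeasurable (X i) ((P i).map (Y i)) := fun i ↦ by
    rw [hmap i]
    exact h.forall_aemeasurable i
  have hXY : ∀ i, AEMeasurable (fun ω ↦ X i (Y i ω)) (P i) := fun i ↦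
    (hX i).comp_aemeasurable (hY i)
  refine ⟨hXY, h.aemeasurable_limit, ?_⟩
  have key : (fun i ↦ (⟨(P i).map (fun ω ↦ X i (Y i ω)),
      Measure.isProbabilityMeasure_map (hXY i)⟩ : ProbabilityMeasure E)) =
      fun i ↦ ⟨(μ i).map (X i), Measure.isProbabilityMeasure_map (h.forall_aemeasurable i)⟩ := by
    funext i
    apply Subtype.ext
    change (P i).map (fun ω ↦ X i (Y i ω)) = (μ i).map (X i)
    rw [← hmap i, AEMeasurable.map_map_of_aemeasurable (hX i) (hY i)]
    rfl
  rw [key]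
  exact h.tendsto

/-! ### 6. The composition (kernel-checked, no `sorry`) -/

open Summit.CriticalPhenomena.SAWScalingLimit.Theorems.SubseqIdentification.Negative
  (eventually_isProbabilityMeasure_of_tendsto) in
/-- **The five stubs imply the crux `IGMartingaleLimit` BY NAME.** Given the crux's data `(D; a, b)`,
`s n → 0⁺`, a probability weak limit `μ`, a chordal uniformizing map `φ` (describability is not even
used: the KS theorem re-derives it): (E) pass to a boundary-attached approximation `(a', b')` with the
same limit along `s`; (0) shift the sequence so that the laws are probability measures and the meshes
positive; (K) Kemppainen–Smirnov data `(D_k, φ_k, Y_k)`; KS theorem in approximating domains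
(`ae_isLoewnerDescribable_and_tendstoInDistribution_drivingPath_varying`, PROVED) + transport to the
lattice spaces ⇒ `V^k = drivingFunction φ_k ∘ Y_k → W = drivingFunction φ` in distribution; (C, fed by M)
clock data for `(z; s', t₁)`, packaged by `Loewner.exists_discreteMartingaleData_of_clocks_of` (PROVED)
into the hypothesis of the passage theorem `Loewner.integral_cylinder_eq_zero_of_discreteMartingales`
(PROVED), which with (A) and `|H| ≤ 6` gives the cylinder identity for `s' < t₁ < T(z)`; extension to all
`s' ≤ t'` by the frozen-functional lemma; real part. -/
theorem IGMartingaleLimit_of (hA : __Registered.stub_igContinuity)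
    (hE : __Registered.stub_endpointTransfer) (hK : __Registered.stub_sawKSData)
    (hM : __Registered.stub_flowLineMeanValue) (hC : __Registered.stub_latticeIGClock) :
    Summit.CriticalPhenomena.SAWScalingLimit.Theses.SAWImaginaryGeometry.IGMartingaleLimit := by
  intro D a b hab s μ hs hμ hlim φ hφ _hdesc H z hz s' t' hst n S hS ψ hψc hψb
  haveI := hμ
  -- the Loewner transform as a process on the curve space, and the crux's `H` through it
  set W : ℝ≥0 → CurveClass ℂ → ℝ := fun u c ↦ drivingFunction φ c u with hWdef
  have hWc : ∀ c, Continuous (W · c) := fun c ↦ continuous_drivingFunction φ c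
  change ∫ c, (igProcess W z t' c - igProcess W z s' c) * ψ (fun k ↦ W (S k) c) ∂μ = 0
  -- (E) a boundary-attached approximation with the same limit along `s`
  obtain ⟨a', b', hab', haA, hbA, hlim'⟩ := hE D a b hab s μ hs hμ hlim
  -- (0) probability laws and positive meshes from some index on: shift the sequence
  have hev1 : ∀ᶠ m in atTop,
      IsProbabilityMeasure (SAW.law D.carrier (s m) (a' (s m)) (b' (s m))) :=
    eventually_isProbabilityMeasure_of_tendsto (Ω := D.carrier) (a := a') (b := b') (hlim' 1)
  have hev2 : ∀ᶠ m in atTop, s m ∈ Ioi (0 : ℝ) := hs.eventually eventually_mem_nhdsWithin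
  obtain ⟨N₀, hN₀⟩ := (hev1.and hev2).exists_forall_of_atTop
  set s₁ : ℕ → ℝ := fun m ↦ s (m + N₀) with hs₁def
  haveI hP₁ : ∀ m, IsProbabilityMeasure (SAW.law D.carrier (s₁ m) (a' (s₁ m)) (b' (s₁ m))) :=
    fun m ↦ (hN₀ _ (Nat.le_add_left N₀ m)).1
  have hs₁pos : ∀ m, 0 < s₁ m := fun m ↦ (hN₀ _ (Nat.le_add_left N₀ m)).2
  have hs₁ : Tendsto s₁ atTop (𝓝[>] (0 : ℝ)) := hs.comp (tendsto_add_atTop_nat N₀)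
  have hs₁0 : Tendsto s₁ atTop (𝓝 (0 : ℝ)) := tendsto_nhds_of_tendsto_nhdsWithin hs₁
  have hlim₁ : ∀ f : CurveClass ℂ →ᵇ ℝ, Tendsto (fun m ↦ ∫ γ, f γ.curve
      ∂(SAW.law D.carrier (s₁ m) (a' (s₁ m)) (b' (s₁ m)))) atTop (𝓝 (∫ x, f x ∂μ)) :=
    fun f ↦ (hlim' f).comp (tendsto_add_atTop_nat N₀)
  -- (K) Kemppainen–Smirnov data of the boundary-attached laws
  obtain ⟨Ds, φs, Y, hφs, hU1, hU2, hb, hclose, hYlim, hbox⟩ :=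
    hK D a' b' hab' haA hbA φ hφ s₁ μ hs₁pos hs₁0 hlim₁
  -- the lattice probability spaces and the laws of the modified curves
  set P : ∀ k : ℕ, Measure (SAW.DomainSAW D.carrier (s₁ k) (a' (s₁ k)) (b' (s₁ k))) :=
    fun k ↦ SAW.law D.carrier (s₁ k) (a' (s₁ k)) (b' (s₁ k)) with hPdef
  haveI hPk : ∀ k, IsProbabilityMeasure (P k) := fun k ↦ hP₁ k
  have hYm : ∀ k, AEMeasurable (Y k) (P k) := fun k ↦
    (SAW.DomainSAW.measurable_of_top _).aemeasurable
  set μs : ℕ → Measure (CurveClass ℂ) := fun k ↦ (P k).map (Y k) with hμsdef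
  haveI hμsP : ∀ k, IsProbabilityMeasure (μs k) := fun k ↦
    Measure.isProbabilityMeasure_map (hYm k)
  have hlimμs : ∀ f : CurveClass ℂ →ᵇ ℝ,
      Tendsto (fun k ↦ ∫ c, f c ∂μs k) atTop (𝓝 (∫ c, f c ∂μ)) := by
    intro f
    have hint : ∀ k, ∫ c, f c ∂μs k = ∫ ω, f (Y k ω) ∂P k := fun k ↦
      integral_map (hYm k) f.continuous.aestronglyMeasurable
    simp_rw [hint]
    exact hYlim f
  -- box tightness, in the form of laws
  have hbox' : ∀ ε : ℝ≥0∞, 0 < ε → ∃ (δγ δW : ℕ → ℝ) (T : ℕ → ℝ≥0), (∀ j, 0 < δγ j) ∧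
      (∀ j, 0 < δW j) ∧
      ∀ k, μs k ((fun p ↦ compactifiedClass (φs k).boundaryExtension ((Ds k).pt 1) p.1) ''
        {p : C(ℝ≥0, ℂ) × C(ℝ≥0, ℝ) | p ∈ generatedPairs ∧
          p.1 ∈ Literature.Probability.Process.modulusSet ({0} : Set ℂ) δγ ∧ p.2 ∈ Literature.Probability.Process.modulusSet ({0} : Set ℝ) δW ∧
          ∀ (j : ℕ) (t : ℝ≥0), T j ≤ t → (j : ℝ) ≤ ‖p.1 t‖})ᶜ ≤ ε := by
    intro ε hε
    obtain ⟨δγ, δW, T, hδγ, hδW, hall⟩ := hbox ε hε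
    refine ⟨δγ, δW, T, hδγ, hδW, fun k ↦ ?_⟩
    set 𝒦 : Set (C(ℝ≥0, ℂ) × C(ℝ≥0, ℝ)) := {p | p ∈ generatedPairs ∧
      p.1 ∈ Literature.Probability.Process.modulusSet ({0} : Set ℂ) δγ ∧ p.2 ∈ Literature.Probability.Process.modulusSet ({0} : Set ℝ) δW ∧
      ∀ (j : ℕ) (t : ℝ≥0), T j ≤ t → (j : ℝ) ≤ ‖p.1 t‖} with h𝒦def
    have h𝒦 : IsCompact 𝒦 := isCompact_pairBox hδγ hδW T
    have hgen : 𝒦 ⊆ generatedPairs := fun p hp ↦ hp.1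
    have htrans : ∀ r : ℝ, ∃ T' : ℝ≥0, ∀ p ∈ 𝒦, ∀ t, T' ≤ t → r ≤ ‖p.1 t‖ := fun r ↦
      ⟨T ⌈r⌉₊, fun p hp t ht ↦ (Nat.le_ceil r).trans (hp.2.2.2 _ t ht)⟩
    have hclosed : IsClosed ((fun p ↦ compactifiedClass (φs k).boundaryExtension ((Ds k).pt 1)
        p.1) '' 𝒦) :=
      (isClosed_image_and_continuousOn_drivingPath (hφs k) h𝒦 hgen htrans).2.2.1
    change ((P k).map (Y k)) _ ≤ ε
    rw [Measure.map_apply_of_aemeasurable (hYm k) hclosed.measurableSet.compl]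
    exact hall k
  -- Kemppainen–Smirnov in approximating domains, transported to the lattice spaces
  obtain ⟨-, hTD⟩ :=
    ae_isLoewnerDescribable_and_tendstoInDistribution_drivingPath_varying hφ hφs hU1 hU2 hb
      hlimμs hbox'
  have hTD' := tendstoInDistribution_comp_of_map_eq hTD Y hYm fun k ↦ rfl
  set V : ∀ k : ℕ, ℝ≥0 → SAW.DomainSAW D.carrier (s₁ k) (a' (s₁ k)) (b' (s₁ k)) → ℝ :=
    fun k u γ ↦ drivingFunction (φs k) (Y k γ) u with hVdef
  have hVc : ∀ k γ, Continuous (V k · γ) := fun k γ ↦ continuous_drivingFunction (φs k) (Y k γ)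
  have hlaw : TendstoInDistribution (fun k γ ↦ (⟨fun u ↦ V k u γ, hVc k γ⟩ : C(ℝ≥0, ℝ))) atTop
      (fun c ↦ (⟨fun u ↦ W u c, hWc c⟩ : C(ℝ≥0, ℝ))) P μ := hTD'
  -- (A) joint continuity; (C, M) clock data; packaging and passage for `s' < t₁ < T(z)`
  have hNc : Continuous (Function.uncurry (igFunctional z)) := hA z hz
  have hpass : ∀ t₁ : ℝ≥0, s' < t₁ → t₁ < igTime z →
      ∫ c, (igFunctional z t₁ ⟨fun r ↦ W r c, hWc c⟩ - igFunctional z s' ⟨fun r ↦ W r c, hWc c⟩) *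
        (ψ (fun i ↦ W (S i) c) : ℂ) ∂μ = 0 := by
    intro t₁ hst₁ ht₁
    obtain ⟨C, ε, Δ, η, hε, hΔ, hη, hk⟩ := hC hM D a' b' hab' haA hbA φ hφ s₁ hs₁pos hs₁0 Ds φs Y
      hφs hU1 hU2 hb hclose hbox z hz s' t₁ hst₁ ht₁
    have hk' : ∀ k, ∃ (𝒢 : Filtration ℕ (inferInstance :
          MeasurableSpace (SAW.DomainSAW D.carrier (s₁ k) (a' (s₁ k)) (b' (s₁ k)))))
        (θ : ℕ → SAW.DomainSAW D.carrier (s₁ k) (a' (s₁ k)) (b' (s₁ k)) → ℝ≥0) (M : ℕ)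
        (X : SAW.DomainSAW D.carrier (s₁ k) (a' (s₁ k)) (b' (s₁ k)) → ℂ) (c : ℂ)
        (bad : Set (SAW.DomainSAW D.carrier (s₁ k) (a' (s₁ k)) (b' (s₁ k)))),
        Adapted 𝒢 θ ∧ (∀ ω, ω ∉ bad → θ 0 ω ≤ Δ k) ∧ (∀ u, Measurable[𝒢 M] (V k u)) ∧
        (∀ n u, Measurable[𝒢 n] ({ω | u ≤ θ n ω}.indicator (V k u))) ∧
        AEStronglyMeasurable X (P k) ∧ (∀ᵐ ω ∂P k, ‖X ω‖ ≤ 1) ∧ ‖c‖ ≤ C ∧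
        MeasurableSet bad ∧ P k bad ≤ η k ∧
        (∀ ω, ω ∉ bad → ∃ n ≤ M, t₁ ≤ θ n ω) ∧
        (∀ ω, ω ∉ bad → ∀ n, n < M → θ (n + 1) ω ≤ θ n ω + Δ k) ∧
        (∀ᵐ ω ∂P k, ω ∉ bad → ∀ n, n ≤ M → θ n ω ≤ t₁ + Δ k →
          ‖c * (P k)[X|𝒢 n] ω - (igProcess (V k) z (θ n ω) ω : ℂ)‖ ≤ ε k) := by
      intro k
      obtain ⟨𝒢, θ, M, A, aM, zk, hW, L, c, bad, -, hθ, hθ0, hVM, hVloc, hXm, hX1, hcC, hbad,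
        hPbad, hreach, hincr, happrox⟩ := hk k
      exact ⟨𝒢, θ, M, _, c, bad, hθ, hθ0, hVM, hVloc, hXm, hX1, hcC, hbad, hPbad, hreach, hincr,
        happrox⟩
    obtain ⟨C', ε', Δ', η', hε', hΔ', hη', hD⟩ :=
      Loewner.exists_discreteMartingaleData_of_clocks_of (P := P) (V := V)
        (fun k u ω ↦ (igProcess (V k) z u ω : ℂ)) hst₁ hε hΔ hη hk'
    have hobsV : ∀ k u ω, (igProcess (V k) z u ω : ℂ) =
        igFunctional z u ⟨fun r ↦ V k r ω, hVc k ω⟩ := fun k u ω ↦ rfl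
    simp only [hobsV] at hD
    exact Loewner.integral_cylinder_eq_zero_of_discreteMartingales (P := P) hWc hVc hlaw hNc
      (norm_igFunctional_le z) s' t₁ hS hψc hψb hε' hΔ' hη' hD
  -- all `s' ≤ t'` (the functional is frozen after `T(z)`, continuous in time, bounded)
  have hCyl := integral_cylinder_eq_zero_of_forall_lt_of_frozen hWc hlaw.aemeasurable_limit hNc
    (norm_igFunctional_le z) (T := igTime z) (fun u hu w ↦ igFunctional_of_le hu w) S hψc hψb
    hpass hst
  -- complex ⟹ real
  have hint : ∫ c, (((igProcess W z t' c - igProcess W z s' c) * ψ (fun k ↦ W (S k) c) : ℝ) : ℂ) ∂μ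
      = ∫ c, (igFunctional z t' ⟨fun r ↦ W r c, hWc c⟩ - igFunctional z s' ⟨fun r ↦ W r c, hWc c⟩) *
          (ψ (fun i ↦ W (S i) c) : ℂ) ∂μ := by
    refine integral_congr_ae (ae_of_all _ fun c ↦ ?_)
    simp only [← igProcess_eq_igFunctional W hWc]
    push_cast
    ring
  rw [hCyl, integral_complex_ofReal] at hint
  exact_mod_cast hint

/-- Wiring check: the registered stubs feed `IGMartingaleLimit_of` as stated. -/
example : Summit.CriticalPhenomena.SAWScalingLimit.Theses.SAWImaginaryGeometry.IGMartingaleLimit :=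
  IGMartingaleLimit_of stub_igContinuity stub_endpointTransfer stub_sawKSData stub_flowLineMeanValue
    stub_latticeIGClock

end Summit.CriticalPhenomena.SAWScalingLimit.Cruxes.IGMartingaleLimit.KSClock

end
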